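import Summits.QuantumAdvantage.Statement
import Summits.QuantumAdvantage.QuantumAdvantage.Theorems.MobiusLadderLiouvilleMemBQP
import Summits.QuantumAdvantage.QuantumAdvantage.Theorems.SosSandwichRandomOracleHeurSeparationDefs
import Summits.QuantumAdvantage.QuantumAdvantage.Theorems.SosSandwichRandomOracleHeurSeparationStubAlmostAvgPHeur
import Literature.Computability.Complexity.AvgPRel
import Literature.Computability.Complexity.AlmostP
import Literature.Computability.Complexity.BPPSubsetAlmostP
import Literature.Computability.MetaComplexity.HeuristicClasses
import HarnessLib

/-!
# Crux `RandomOracleHeurSeparation` (stmt-QuantumAdvantage-1131 / 15239), line `birth` — the one open stub is SUMMIT-STRENGTH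

Kernel certificate for the census of route SosSandwich (leaf `RandomOracleHeurSeparation`, X_ROG): the
registered skeleton `Cruxes/RandomOracleHeurSeparation/Lines/birth.lean` (sha 58eec551…) composes the crux
from ONE open stub,

  `stub_liouville_heurHard : ∃ δ : ℝ, 0 < δ ∧ (⟨liouvilleLang, uniformEnsemble⟩ : DistProblem) ∉ HeurDeltaBPP (fun _ => δ)`

("the Liouville function is not heuristically `BPP`-computable on uniform integers, for some constant failure
rate").  This file proves that the STATEMENT of that stub implies the summit `QuantumAdvantage`
(`∃ L, L ∈ BQP ∧ L ∉ BPP`) OUTRIGHT — without the crux, without the route's other items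
(`PseudoBoundedAA`, `TransferPB`, `PromiseLanguageLift`): the witness is `L_λ` itself, in `BQP` by the tree
theorem `Theorems.MobiusLadder.LiouvilleMemBQP_proof` (Shor), and outside `BPP` because every `BPP` language is
heuristically `BPP` with every constant failure rate on the uniform ensemble (`heurConstBPP_of_mem_BPP`, here
obtained from built tree theorems only: Bennett–Gill `BPP ⊆ ALMOST-P` (`BPP_subset_almostP_holds`),
`P^A ⊆ AvgP^A` (`PRel_subset_AvgPRel`), and the line's own landed stub 1 `stub_almostAvgP_heur`
(ALMOST-`AvgP ⊆ ⋂_δ Heur_δBPP`)).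

Reading for the planner / census (honest label): the line `birth` of X_ROG is closed MODULO a hypothesis that
is at least as strong as the summit (`stub ⟹ S` here; `S ⟹ stub` is not claimed and not expected: the stub
is an average-case statement about one explicit language) — the line does not reduce the summit's difficulty,
it relocates it onto an explicit arithmetic hypothesis, as
`Literature.Barriers.QuantumAdvantage.SeparationPrerequisites` predicts for every hypothesis-type witness of
X_ROG.  Nothing open is asserted: the theorems below take the stub statement as a hypothesis.

Sources: Shor1997 §5 (`L_λ ∈ BQP` via factoring); BennettGill1981 / BookVollmerWagner1996 §4 (ALMOST-P = BPP);
BogdanovTrevisan2006 Def. 2.13 (`Heur_δBPP`); AaronsonAmbainis2014 §1 p. 5 (the random-oracle heuristic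
separation question).
-/

-- D-0017: single-conjunct summit ⇒ the duplicate `QuantumAdvantage.QuantumAdvantage` is mandated.
set_option linter.dupNamespace false

noncomputable section

namespace Summit.QuantumAdvantage.QuantumAdvantage.Cruxes.RandomOracleHeurSeparation.Birth

open MeasureTheory
open Literature.Computability.Complexity (BPP PRel AvgPRel Oracle almostP PRel_subset_AvgPRel
  BPP_subset_almostP_holds)
open Literature.Computability.Cryptography (BQP)
open Literature.Computability.MetaComplexity (HeurDeltaBPP uniformEnsemble DistProblem)

/-- `ALMOST-P ⊆ ALMOST-AvgP`: a language in `P^A` for almost every oracle `A` is in Aaronson–Ambainis'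
heuristic class `AvgP^A` for almost every `A` (`P^A ⊆ AvgP^A`, `PRel_subset_AvgPRel`; the two random-oracle
laws `randomOracleMeasure` / `randomOracle` are the same measure, reducibly). [folklore] -/
theorem almostP_subset_almostAvgP : almostP ⊆ almostAvgP := by
  intro L hL
  change ∀ᵐ (A : Set (List Bool)) ∂Literature.Computability.QuantumComplexity.randomOracle,
    L ∈ AvgPRel (Oracle.ofLanguage A)
  exact (Literature.Computability.Complexity.mem_almostP_iff.1 hL).mono
    fun A hA => PRel_subset_AvgPRel (Oracle.ofLanguage A) hA

/-- **`BPP` languages are heuristically `BPP` with every constant failure rate on the uniform ensemble**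
(`(BPP, U) ⊆ ⋂_{δ>0} Heur_δBPP`), assembled from built tree theorems: Bennett–Gill `BPP ⊆ ALMOST-P`
(`BPP_subset_almostP_holds`), `ALMOST-P ⊆ ALMOST-AvgP`, and the line's landed stub 1
`stub_almostAvgP_heur` (ALMOST-`AvgP ⊆ ⋂_δ Heur_δBPP`).  (The direct proof — amplify, no input is bad — is
`Theorems.AvgFaceBeyondPrior.Negative.mem_HeurDeltaBPP_of_mem_BPP`; this detour avoids that module.)
[cite: BogdanovTrevisan2006, Def. 2.13] -/
theorem heurConstBPP_of_mem_BPP {L : Language Bool} (hL : L ∈ BPP) : HeurConstBPP L :=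
  stub_almostAvgP_heur L (almostP_subset_almostAvgP (BPP_subset_almostP_holds hL))

/-- **The open stub of line `birth` forces `L_λ ∉ BPP`.** If `(L_λ, U) ∉ Heur_δBPP` for some `δ > 0`, then
the Liouville language is not in `BPP` (`heurConstBPP_of_mem_BPP`). [cite: BogdanovTrevisan2006, Def. 2.13] -/
theorem liouvilleLang_not_mem_BPP_of_stub
    (h : ∃ δ : ℝ, 0 < δ ∧ (⟨liouvilleLang, uniformEnsemble⟩ : DistProblem) ∉ HeurDeltaBPP (fun _ => δ)) :
    liouvilleLang ∉ BPP := by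
  rintro hBPP
  obtain ⟨δ, hδ, hnot⟩ := h
  exact hnot (heurConstBPP_of_mem_BPP hBPP δ hδ)

/-- **The open stub of line `birth` is summit-strength**: the statement of `stub_liouville_heurHard`
implies `QuantumAdvantage` (`∃ L ∈ BQP, L ∉ BPP`) directly, with witness `L_λ` — `L_λ ∈ BQP` is the tree
theorem `Theorems.MobiusLadder.LiouvilleMemBQP_proof` (Shor's factoring algorithm) and `L_λ ∉ BPP` is
`liouvilleLang_not_mem_BPP_of_stub`.  So the registered line of crux `RandomOracleHeurSeparation` is closed
modulo a hypothesis at least as strong as the summit itself (census tag: STRONGER-OR-EQUAL, not a reduction).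
[cite: Shor1997, §5] -/
theorem quantumAdvantage_of_stub_liouville_heurHard
    (h : ∃ δ : ℝ, 0 < δ ∧ (⟨liouvilleLang, uniformEnsemble⟩ : DistProblem) ∉ HeurDeltaBPP (fun _ => δ)) :
    _root_.QuantumAdvantage :=
  ⟨liouvilleLang, Summit.QuantumAdvantage.QuantumAdvantage.Theorems.MobiusLadder.LiouvilleMemBQP_proof,
    liouvilleLang_not_mem_BPP_of_stub h⟩

/-- Contrapositive, for refuters of the stub: were the summit false (`BQP ⊆ BPP` in the existential form),
the Liouville language would be heuristically `BPP`-easy on uniform integers with EVERY constant failure rate —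
the stub dies with the summit, not only with the random-oracle gauge. [cite: Shor1997, §5] -/
theorem heurConstBPP_liouville_of_not_summit (hS : ¬ _root_.QuantumAdvantage) : HeurConstBPP liouvilleLang := by
  by_contra hH
  refine hS ⟨liouvilleLang, Summit.QuantumAdvantage.QuantumAdvantage.Theorems.MobiusLadder.LiouvilleMemBQP_proof,
    fun hBPP => hH (heurConstBPP_of_mem_BPP hBPP)⟩

/-- **The crux itself is at least the famous-open WORST-CASE random-oracle separation** (decomp-qadv
lens-3 g23 «TailDial», `w_of_xrog`, here landed): `RandomOracleHeurSeparation` (X_ROG: not a.s. `BQP^A ⊆ AvgP^A`)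
implies `W`: not a.s. `BQP^A ⊆ P^A` — "is `BQP^A ⊄ BPP^A`/`P^A` for a random oracle with probability 1?"
(Fortnow–Rogers 1999 §5, Aaronson–Ambainis 2014 p. 5: open) — since `P^A ⊆ AvgP^A` for every oracle
(`PRel_subset_AvgPRel`).  So every proof of the crux proves `W`. [cite: AaronsonAmbainis2014, §1 (p. 5)] -/
theorem worstCaseSeparation_of_randomOracleHeurSeparation
    (hX : Summit.QuantumAdvantage.QuantumAdvantage.Theses.SosSandwich.RandomOracleHeurSeparation) :
    ¬ ∀ᵐ (A : Set (List Bool)) ∂Literature.Computability.QuantumComplexity.randomOracle,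
      Literature.Computability.Cryptography.BQPRel (A : Language Bool) ⊆ PRel (Oracle.ofLanguage A) := by
  intro hW
  exact hX (hW.mono fun A hA L hL => PRel_subset_AvgPRel (Oracle.ofLanguage A) (hA hL))

end Summit.QuantumAdvantage.QuantumAdvantage.Cruxes.RandomOracleHeurSeparation.Birth

end
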